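import Literature.NumberTheory.EllipticCurves.RingClassFieldSplitting
import Literature.NumberTheory.EllipticCurves.KolyvaginShaStructureIndexFormProofs
import Mathlib.NumberTheory.RamificationInertia.Valuation
import Mathlib.NumberTheory.RamificationInertia.Unramified
import HarnessLib

set_option linter.dupNamespace false
set_option autoImplicit false

/-!
# LINE B49, family F3 (ℓ ≡ 3 mod 8): the ARITHMETIC obstruction — `7β` is not a square in the Hilbert class field
# when `β` is a unit at an unramified prime `𝔮 ∣ 7` of `K`

Cell `bsd-goldfeld`, seat `bsd-goldfeld-s1p-c3x` (prover, gen 3); memo `HOME/F3-ETA-DESCENT.md` §4 / §8 file K3. Support for item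
`stmt-BirchSwinnertonDyer-19350` (`BSDTwoCMSplitRankOne`; no claim, no closure). Theses-free, FACT-FREE, theorems only.

THE POINT. If `v` is a prime of a Dedekind domain `A` (fraction field `K`), `w ∣ v` a prime of `B` (fraction field `L ⊇ K`) with
ramification index `e(w|v) = 1`, then `w(x) = v(x)` for `x ∈ K` (Mathlib `valuation_liesOver`); so an element of ODD `v`-valuation is
not a square in `L`. For `K` imaginary quadratic, `H = K[1]` its Hilbert class field (tree `ringClassField K ι 1`, unramified over `K`:
`isUnramifiedIn_ringClassField`), `𝔮` a prime of `K` with `7 ∈ 𝔮 ∖ 𝔮²` (i.e. `7` unramified at `𝔮`) and `β ∈ 𝓞_K ∖ 𝔮`: `v_𝔮(7β) = 1`, hence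
**`7β ∉ H^{×2}`**. APPLICATION (memo §4): with `β = N_{H/K}(x(y₁) − 2)` (Deuring: a `𝔮`-unit) this contradicts `α(y_K) = α(T)`, i.e.
the Heegner trace `y_K` is never the `2`-torsion point `T` — see the sibling `…TwinEtaDescentClass.lean`.

HONEST FRAMING: elementary valuation theory over Mathlib; proves nothing about Heegner points by itself; BSD is not proved by any of this;
item 19350 unchanged.

References: J. Neukirch, *Algebraic Number Theory* (1999) I §8, II §8 (extension of valuations, `e = 1`) [NeukirchANT1999];
D. A. Cox, *Primes of the form x² + ny²* (2013) §9.A (`K[f]/K` unramified outside `f`) [Cox2013].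
-/

noncomputable section

open scoped Classical

open IsDedekindDomain IsDedekindDomain.HeightOneSpectrum NumberField WithZero
open Literature.NumberTheory.EllipticCurves

namespace Summit.BirchSwinnertonDyer.BirchSwinnertonDyer.Theorems.GoldfeldGoodTwists

/-! ## §1 Valuations: odd valuation downstairs and `e = 1` ⟹ not a square upstairs -/

section Valuation

variable {A K : Type*} (L : Type*) {B : Type*}
variable [CommRing A] [IsDedekindDomain A] [CommRing B] [IsDedekindDomain B] [Algebra A B] [Module.IsTorsionFree A B]
variable [Field K] [Field L] [Algebra K L]
variable [Algebra A K] [IsFractionRing A K] [Algebra A L] [IsScalarTower A K L]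
variable [Algebra B L] [IsFractionRing B L] [IsScalarTower A B L]

/-- **Odd valuation + ramification index one ⟹ not a square upstairs.** If `w ∣ v` with `e(w|v) = 1` and `x ∈ K` has
`v(x) = exp(m)` with `m` odd, then `x` is not a square in `L` (`w(x) = v(x)^{e} = exp(m)` by Mathlib's `valuation_liesOver`, while the
valuation of a square is `exp` of an even integer). [cite: NeukirchANT1999, II (8.5) (valuations in unramified extensions)] -/
theorem not_isSquare_algebraMap_of_valuation_eq_exp_odd (v : HeightOneSpectrum A) (w : HeightOneSpectrum B)
    [w.asIdeal.LiesOver v.asIdeal] (he : v.asIdeal.ramificationIdx' w.asIdeal = 1) {x : K} {m : ℤ} (hm : Odd m)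
    (hx : v.valuation K x = exp m) : ¬ IsSquare (algebraMap K L x) := by
  rintro ⟨s, hs⟩
  have h := HeightOneSpectrum.valuation_liesOver (K := K) L v w x
  rw [he, pow_one, hx, hs, map_mul] at h
  have hs0 : w.valuation L s ≠ 0 := by
    intro h0
    rw [h0, mul_zero] at h
    exact exp_ne_zero h
  rw [← exp_log hs0, ← exp_add, exp_inj] at h
  obtain ⟨k, hk⟩ := hm
  omega

/-- **`v(p·β) = exp(−1)`** for `p ∈ v ∖ v²` (one factor of `v` in `(p)`) and `β ∉ v` (`A` a Dedekind domain, valuation of its fraction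
field `K`). [folklore] -/
theorem valuation_mul_eq_exp_neg_one (v : HeightOneSpectrum A) {p β : A} (hp : p ∈ v.asIdeal) (hp2 : p ∉ v.asIdeal ^ 2)
    (hβ : β ∉ v.asIdeal) : v.valuation K (algebraMap A K (p * β)) = exp (-1 : ℤ) := by
  rw [valuation_of_algebraMap, map_mul]
  have hβ1 : v.intValuation β = 1 := (intValuation_eq_one_iff_mem_primeCompl v β).mpr hβ
  have hp1 : v.intValuation p ≤ exp (-(1 : ℕ) : ℤ) := (intValuation_le_pow_iff_mem v p 1).mpr (by rwa [pow_one])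
  have hp2' : ¬ v.intValuation p ≤ exp (-(2 : ℕ) : ℤ) := fun h ↦ hp2 ((intValuation_le_pow_iff_mem v p 2).mp h)
  have hp0 : p ≠ 0 := by rintro rfl; exact hp2 (Ideal.zero_mem _)
  rw [hβ1, mul_one]
  rw [intValuation_eq_exp_neg_multiplicity v hp0] at hp1 hp2' ⊢
  rw [exp_le_exp] at hp1 hp2'
  rw [exp_inj]
  push_cast at hp1 hp2' ⊢
  omega

end Valuation

/-! ## §2 The Hilbert class field `K[1]`: `7β ∉ K[1]^{×2}` for `β ∈ 𝓞_K ∖ 𝔮`, `7 ∈ 𝔮 ∖ 𝔮²` -/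

section RingClassField

variable {K : Type} [Field K] [NumberField K]

/-- **`pβ` is not a square in the Hilbert class field.** `K` imaginary quadratic, `H = K[1] = ringClassField K ι 1`; `𝔮` a prime of `𝓞_K`
with `p ∈ 𝔮`, `p ∉ 𝔮²` (the rational… any element `p ∈ 𝓞_K` with exactly one factor `𝔮`) and `β ∈ 𝓞_K ∖ 𝔮`. Then `p·β` is not a square
in `H`: `K[1]/K` is unramified at `𝔮` (tree `isUnramifiedIn_ringClassField`, conductor `1`), so `e(𝔔|𝔮) = 1` for a prime `𝔔 ∣ 𝔮` of `H`
(Mathlib `Algebra.IsUnramifiedIn.ramificationIdx_eq_one`) and §1 applies with `v_𝔮(pβ) = exp(−1)`.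
[cite: Cox2013, §9.A (p. 181)] [cite: NeukirchANT1999, II (8.5)] -/
theorem not_isSquare_mul_ringClassField_one (hK : IsImaginaryQuadratic K) (ι : K →+* ℂ) (v : HeightOneSpectrum (𝓞 K))
    {p β : 𝓞 K} (hp : p ∈ v.asIdeal) (hp2 : p ∉ v.asIdeal ^ 2) (hβ : β ∉ v.asIdeal) :
    ¬ IsSquare (algebraMap K (ringClassField K ι 1) ((p * β : 𝓞 K) : K)) := by
  obtain ⟨hfd, hgal⟩ := finiteDimensional_and_isGalois_ringClassField hK ι one_ne_zero
  haveI := hfd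
  haveI : NumberField (ringClassField K ι 1) := numberField_ringClassField hK ι one_ne_zero
  -- `K[1]/K` is unramified at `v` (conductor `1`: the hypothesis `¬ (1) ≤ v` is trivial)
  have hv1 : ¬ Ideal.span {((1 : ℕ) : 𝓞 K)} ≤ v.asIdeal := by
    rw [Nat.cast_one, Ideal.span_singleton_one, top_le_iff]
    exact v.isPrime.ne_top
  have hunr := isUnramifiedIn_ringClassField hK ι one_ne_zero hv1
  -- a prime `w` of `𝓞 K[1]` over `v`
  haveI := v.isMaximal
  obtain ⟨W, hWmax, hWover⟩ :=
    Ideal.exists_maximal_ideal_liesOver_of_isIntegral (S := 𝓞 (ringClassField K ι 1)) v.asIdeal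
  let w : HeightOneSpectrum (𝓞 (ringClassField K ι 1)) :=
    ⟨W, hWmax.isPrime, Ideal.ne_bot_of_liesOver_of_ne_bot v.ne_bot W⟩
  haveI : w.asIdeal.LiesOver v.asIdeal := hWover
  have he : v.asIdeal.ramificationIdx' w.asIdeal = 1 := by
    rw [Ideal.ramificationIdx'_eq_ramificationIdx v.asIdeal w.asIdeal v.ne_bot]
    exact hunr.ramificationIdx_eq_one hWover
  have hval : v.valuation K ((p * β : 𝓞 K) : K) = exp (-1 : ℤ) :=
    valuation_mul_eq_exp_neg_one (K := K) v hp hp2 hβ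
  exact not_isSquare_algebraMap_of_valuation_eq_exp_odd (ringClassField K ι 1) v w he (by decide) hval

end RingClassField

end Summit.BirchSwinnertonDyer.BirchSwinnertonDyer.Theorems.GoldfeldGoodTwists

end
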